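import Summits.CriticalPhenomena.SAWScalingLimit.Theorems.SAWDefectDecoherenceBoundaryClosureRBoundaryExactness
import HarnessLib

/-!
# Crux `BoundaryClosureR` (stmt-CriticalPhenomena-14004), line `polygon-parity-squeeze`:
# the corner steps of the winding at the lattice corners of forms `0` and `3`
# (support for the corner phase relation `sidePhase_corner`, sub-goal (A1b') of
# `stub_polygonIdentification`)

At an exact lattice corner of a hexagonal domain `Λ` whose first side is a floor of row `n`
(form `0`, darts heading `-90°`) and whose second side is a column `x₀ = a` of form `3` (darts
heading `-30°`), convex (`120°`) or reflex (`240°`), a walk from the boundary root that reaches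
the window of faces joining the last floor dart `e₀` to the first column dart `e₁` can be cut at
its FIRST visit to the window and rerouted to both darts (`first_visit`,
`BoundaryExactness.exists_extend`); the two reroutings have windings differing by the turning
`+π/3` of the boundary at the corner:

* `step_three_convex` (window `(a,n,0), (a,n,1)`; entrances from the west or from above);
* `step_three_reflex` (window `(a+1,n,0), (a,n,1), (a,n,0), (a,n-1,1)`; four entrances).

The turn counts of the exits are read in the coordinate model `HV` (`winding = (π/3)·pturn`).
Combined with winding rigidity and the flat transfers of `…SidePhaseCornerFlat` they give the
phase jump `e^{-i(5/8)T}` across a corner; the corners of forms `0`, `2` are the companion file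
`…SidePhaseCornerStepsTwo`.  Sources: H. Duminil-Copin, S. Smirnov, Ann. of Math. 175 (2012),
§3.  No definition is introduced.
-/

noncomputable section

open Literature.Probability.LatticeModels Literature.Probability.RandomPlanarGeometry.SAW
open Literature.Probability.RandomPlanarGeometry.SAW.HV
open Summit.CriticalPhenomena.SAWScalingLimit.Theorems.PickHalfPlane.BoundaryExactness

namespace Summit.CriticalPhenomena.SAWScalingLimit.Theorems.PolygonParitySqueeze

namespace SidePhaseCorner

variable {Λ : Finset HexVertex}

/-! ### 1. Neighbours in coordinates and the first visit of a walk to a window -/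

/-- The three neighbours of an up face `(i,j,0)`: `(i,j,1)`, `(i-1,j,1)`, `(i,j-1,1)`, in
coordinates. [folklore] -/
theorem adj_up_coord {p : HexVertex} {i j : ℤ} (h : hexGraph.Adj p (![i, j], 0)) :
    p.2 = 1 ∧ ((p.1 0 = i ∧ p.1 1 = j) ∨ (p.1 0 = i - 1 ∧ p.1 1 = j) ∨ (p.1 0 = i ∧ p.1 1 = j - 1)) := by
  rcases (hexGraph_adj_iff_coord p.1 (![i, j]) p.2 0).1 h with ⟨-, h10, -⟩ | ⟨h2, -, h01⟩
  · exact absurd h10 (by decide)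
  · simp only [Matrix.cons_val_zero, Matrix.cons_val_one] at h01
    exact ⟨h2, h01⟩

/-- The three neighbours of a down face `(i,j,1)`: `(i,j,0)`, `(i+1,j,0)`, `(i,j+1,0)`, in
coordinates. [folklore] -/
theorem adj_down_coord {p : HexVertex} {i j : ℤ} (h : hexGraph.Adj p (![i, j], 1)) :
    p.2 = 0 ∧ ((p.1 0 = i ∧ p.1 1 = j) ∨ (p.1 0 = i + 1 ∧ p.1 1 = j) ∨ (p.1 0 = i ∧ p.1 1 = j + 1)) := by
  rcases (hexGraph_adj_iff_coord p.1 (![i, j]) p.2 1).1 h with ⟨h2, -, h01⟩ | ⟨-, h10, -⟩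
  · simp only [Matrix.cons_val_zero, Matrix.cons_val_one] at h01
    refine ⟨h2, ?_⟩
    rcases h01 with ⟨h0, h1⟩ | ⟨h0, h1⟩ | ⟨h0, h1⟩
    · exact Or.inl ⟨h0.symm, h1.symm⟩
    · exact Or.inr (Or.inl ⟨by omega, h1.symm⟩)
    · exact Or.inr (Or.inr ⟨h0.symm, by omega⟩)
  · exact absurd h10 (by decide)

/-- **The first visit of a walk to a window.** A walk `δ` from the boundary root `{u, w}`
(`u ∉ Λ`) meeting a list `Z` of faces of `Λ` splits at its first vertex `zv ∈ Z` as `A ++ zv :: B`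
with `A` avoiding `Z`; the vertex `p` before `zv` (the last of `u :: A`) is adjacent to `zv`, is
not in `Z`, and lies off `Λ` only if it is `u` itself, the first visit then being `w`. [folklore] -/
theorem first_visit {u w : HexVertex} {z : Sym2 HexVertex} (hu : u ∉ Λ) (huw : hexGraph.Adj u w)
    (δ : HexMidEdgeSAW Λ s(u, w) z) (Z : List HexVertex) (hZ : ∀ x ∈ Z, x ∈ Λ)
    (hvis : ∃ v ∈ δ.verts, v ∈ Z) :
    ∃ (A B : List HexVertex) (zv p : HexVertex), δ.verts = A ++ zv :: B ∧ zv ∈ Z ∧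
      (∀ x ∈ A, x ∉ Z) ∧ (u :: A).getLast (List.cons_ne_nil _ _) = p ∧ hexGraph.Adj p zv ∧
      (∀ x : HexVertex, x ∉ Λ → p = x → u = x ∧ zv = w) ∧ (∀ x ∈ Z, p ≠ x) := by
  classical
  obtain ⟨A, zv, B, hsplit, hzv, hA⟩ := exists_first_mem_split' _ δ.verts hvis
  have hne : δ.verts ≠ [] := by rw [hsplit]; simp
  have hhead : δ.verts.head hne = w := δ.head_eq rfl hu hne
  obtain ⟨p, hp⟩ : ∃ p, (u :: A).getLast (List.cons_ne_nil _ _) = p := ⟨_, rfl⟩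
  have hpadj : hexGraph.Adj p zv := by
    have hch : ((u :: A) ++ zv :: B).IsChain hexGraph.Adj := by
      rw [List.cons_append]
      refine List.isChain_cons.2 ⟨fun y hy => ?_, hsplit ▸ δ.isChain⟩
      have h1 : (A ++ zv :: B).head? = some w := by
        rw [← hhead, ← List.head?_eq_some_head hne, hsplit]
      rw [h1, Option.mem_def, Option.some_inj] at hy
      rw [← hy]; exact huw
    rw [← hp]
    exact hch.rel_getLast_head_of_append (List.cons_ne_nil _ _) (List.cons_ne_nil _ _)
  have hp_or : p = u ∨ p ∈ A := by
    by_cases hA0 : A = []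
    · left; rw [← hp]; simp [hA0]
    · right; rw [← hp, List.getLast_cons hA0]; exact List.getLast_mem hA0
  have hpout : ∀ x : HexVertex, x ∉ Λ → p = x → u = x ∧ zv = w := by
    intro x hx hpx
    rcases hp_or with h | h
    · refine ⟨h ▸ hpx, ?_⟩
      have hA0 : A = [] := by
        by_contra hA0
        rw [← hp, List.getLast_cons hA0] at h
        exact hu (δ.subset u (by rw [hsplit]; exact List.mem_append_left _ (h ▸ List.getLast_mem hA0)))
      rw [← hhead]; simp [hsplit, hA0]
    · exact absurd (δ.subset p (by rw [hsplit]; exact List.mem_append_left _ h)) (hpx ▸ hx)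
  have hpZ : ∀ x ∈ Z, p ≠ x := by
    rintro x hxZ rfl
    rcases hp_or with h | h
    · exact hu (h ▸ hZ _ hxZ)
    · exact hA _ h hxZ
  exact ⟨A, B, zv, p, hsplit, hzv, hA, hp, hpadj, hpout, hpZ⟩

/-! ### 2. The `120°` corner: floor of row `n`, then the column `x₀ = a` of form `3` -/

/-- **Corner step at a convex corner of forms `0`, `3` (`120°`).** Window: the last floor up face
`U = (a,n,0)` (its dart hangs down to `(a,n-1,1) ∉ Λ`) and the first column face `M = (a,n,1)`
(its dart heads `-30°` to `(a+1,n,0) ∉ Λ`), neither dart being the root.  A walk from the root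
meeting the window is rerouted at its first visit (at `U` from the west, or at `M` from above) to
both darts, and the winding to the column dart exceeds the winding to the floor dart by `π/3`.
[cite: DuminilCopinSmirnov2012, §3 (winding of walks to the boundary)] -/
theorem step_three_convex {u w : HexVertex} (hu : u ∉ Λ) (huw : hexGraph.Adj u w) {a n : ℤ}
    (hU : ((![a, n], 0) : HexVertex) ∈ Λ) (hM : ((![a, n], 1) : HexVertex) ∈ Λ)
    (hB : ((![a, n - 1], 1) : HexVertex) ∉ Λ) (hE : ((![a + 1, n], 0) : HexVertex) ∉ Λ)
    (h0 : s(u, w) ≠ s(((![a, n - 1], 1) : HexVertex), ((![a, n], 0) : HexVertex)))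
    (h1 : s(u, w) ≠ s(((![a + 1, n], 0) : HexVertex), ((![a, n], 1) : HexVertex)))
    {z : Sym2 HexVertex} (δ : HexMidEdgeSAW Λ s(u, w) z)
    (hvis : ∃ v ∈ δ.verts, v ∈ [((![a, n], 0) : HexVertex), (![a, n], 1)]) :
    ∃ (γ₀ : HexMidEdgeSAW Λ s(u, w) s(((![a, n - 1], 1) : HexVertex), ((![a, n], 0) : HexVertex)))
      (γ₁ : HexMidEdgeSAW Λ s(u, w) s(((![a + 1, n], 0) : HexVertex), ((![a, n], 1) : HexVertex))),
      γ₁.winding = γ₀.winding + Real.pi / 3 := by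
  have hZ : ∀ x ∈ [((![a, n], 0) : HexVertex), (![a, n], 1)], x ∈ Λ := by
    simp only [List.mem_cons, List.not_mem_nil, or_false]
    rintro x (rfl | rfl) <;> assumption
  obtain ⟨A, B, zv, p, hsplit, hzv, hA, hp, hpadj, hpout, hpZ⟩ := first_visit hu huw δ _ hZ hvis
  have hAS : ∀ S : List HexVertex, (∀ x ∈ S, x ∈ [((![a, n], 0) : HexVertex), (![a, n], 1)]) →
      ∀ x ∈ A, x ∉ S := fun S hS x hx hxS => hA x hx (hS x hxS)
  have aBU : hexGraph.Adj ((![a, n - 1], 1) : HexVertex) (![a, n], 0) := by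
    rw [hexGraph_adj_iff_coord]; simp
  have aEM : hexGraph.Adj ((![a + 1, n], 0) : HexVertex) (![a, n], 1) := by
    rw [hexGraph_adj_iff_coord]; simp
  have aUM : hexGraph.Adj ((![a, n], 0) : HexVertex) (![a, n], 1) := by
    rw [hexGraph_adj_iff_coord]; simp
  simp only [List.mem_cons, List.not_mem_nil, or_false] at hzv
  rcases hzv with rfl | rfl
  · -- first visit at the up face `U`: from `M` (excluded), from the west, or from below (the root)
    obtain ⟨h2, ⟨hx, hy⟩ | ⟨hx, hy⟩ | ⟨hx, hy⟩⟩ := adj_up_coord hpadj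
    · exact absurd (eq_mk_of_coord hx hy h2) (hpZ _ (by simp))
    · have hpe : p = (![a - 1, n], 1) := eq_mk_of_coord hx hy h2
      subst hpe
      obtain ⟨γ₀, h₀⟩ := exists_extend hu huw δ hsplit [] (![a, n - 1], 1) (![a, n], 0)
        (by simpa using hU) (List.nodup_singleton _) (List.isChain_singleton _)
        (hAS _ (by simp)) rfl hB aBU h0
      obtain ⟨γ₁, h₁⟩ := exists_extend hu huw δ hsplit [(![a, n], 1)] (![a + 1, n], 0) (![a, n], 1)
        (by simp only [List.mem_cons, List.not_mem_nil, or_false]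
            rintro x (rfl | rfl) <;> assumption)
        (by simp) (List.isChain_pair.2 aUM) (hAS _ (by simp)) rfl hE aEM h1
      refine ⟨γ₀, γ₁, ?_⟩
      rw [hp] at h₀ h₁
      simp only [List.nil_append, List.cons_append, List.map_cons, List.map_nil, toHV_up,
        toHV_down] at h₀ h₁
      have e₀ : pturn [(a - 1, n, true), (a, n, false), (a, n - 1, true)] = -1 := by
        simp only [pturn, turn, cross, pos, Bool.false_eq_true, ↓reduceIte, Prod.mk_sub_mk]
        ring_nf; rfl
      have e₁ : pturn [(a - 1, n, true), (a, n, false), (a, n, true), (a + 1, n, false)] = 0 := by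
        simp only [pturn, turn, cross, pos, Bool.false_eq_true, ↓reduceIte, Prod.mk_sub_mk]
        ring_nf; rfl
      rw [h₀, h₁, e₀, e₁]; push_cast; ring
    · obtain ⟨hux, hzw⟩ := hpout _ hB (eq_mk_of_coord hx hy h2)
      exact absurd (by rw [hux, ← hzw]) h0
  · -- first visit at the down face `M`: from `U` (excluded), from the east (the root), from above
    obtain ⟨h2, ⟨hx, hy⟩ | ⟨hx, hy⟩ | ⟨hx, hy⟩⟩ := adj_down_coord hpadj
    · exact absurd (eq_mk_of_coord hx hy h2) (hpZ _ (by simp))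
    · obtain ⟨hux, hzw⟩ := hpout _ hE (eq_mk_of_coord hx hy h2)
      exact absurd (by rw [hux, ← hzw]) h1
    · have hpe : p = (![a, n + 1], 0) := eq_mk_of_coord hx hy h2
      subst hpe
      obtain ⟨γ₁, h₁⟩ := exists_extend hu huw δ hsplit [] (![a + 1, n], 0) (![a, n], 1)
        (by simpa using hM) (List.nodup_singleton _) (List.isChain_singleton _)
        (hAS _ (by simp)) rfl hE aEM h1
      obtain ⟨γ₀, h₀⟩ := exists_extend hu huw δ hsplit [(![a, n], 0)] (![a, n - 1], 1) (![a, n], 0)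
        (by simp only [List.mem_cons, List.not_mem_nil, or_false]
            rintro x (rfl | rfl) <;> assumption)
        (by simp) (List.isChain_pair.2 aUM.symm) (hAS _ (by simp)) rfl hB aBU h0
      refine ⟨γ₀, γ₁, ?_⟩
      rw [hp] at h₀ h₁
      simp only [List.nil_append, List.cons_append, List.map_cons, List.map_nil, toHV_up,
        toHV_down] at h₀ h₁
      have e₀ : pturn [(a, n + 1, false), (a, n, true), (a, n, false), (a, n - 1, true)] = 0 := by
        simp only [pturn, turn, cross, pos, Bool.false_eq_true, ↓reduceIte, Prod.mk_sub_mk]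
        ring_nf; rfl
      have e₁ : pturn [(a, n + 1, false), (a, n, true), (a + 1, n, false)] = 1 := by
        simp only [pturn, turn, cross, pos, Bool.false_eq_true, ↓reduceIte, Prod.mk_sub_mk]
        ring_nf; rfl
      rw [h₀, h₁, e₀, e₁]; push_cast; ring

/-- **Corner step at a reflex corner of forms `0`, `3` (`240°`).** Window: the last floor up face
`U = (a+1,n,0)` (dart down to `(a+1,n-1,1) ∉ Λ`), the two interior faces `(a,n,1)`, `(a,n,0)`, and
the first column face `M = (a,n-1,1)` (dart heading `-30°` to `(a+1,n-1,0) ∉ Λ`), neither dart being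
the root.  A walk from the root meeting the window is rerouted at its first visit (four possible
entrances) to both darts; the winding to the column dart exceeds the winding to the floor dart by
`π/3`. [cite: DuminilCopinSmirnov2012, §3 (winding of walks to the boundary)] -/
theorem step_three_reflex {u w : HexVertex} (hu : u ∉ Λ) (huw : hexGraph.Adj u w) {a n : ℤ}
    (hU : ((![a + 1, n], 0) : HexVertex) ∈ Λ) (hP₁ : ((![a, n], 1) : HexVertex) ∈ Λ)
    (hP₂ : ((![a, n], 0) : HexVertex) ∈ Λ) (hM : ((![a, n - 1], 1) : HexVertex) ∈ Λ)
    (hB : ((![a + 1, n - 1], 1) : HexVertex) ∉ Λ) (hE : ((![a + 1, n - 1], 0) : HexVertex) ∉ Λ)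
    (h0 : s(u, w) ≠ s(((![a + 1, n - 1], 1) : HexVertex), ((![a + 1, n], 0) : HexVertex)))
    (h1 : s(u, w) ≠ s(((![a + 1, n - 1], 0) : HexVertex), ((![a, n - 1], 1) : HexVertex)))
    {z : Sym2 HexVertex} (δ : HexMidEdgeSAW Λ s(u, w) z)
    (hvis : ∃ v ∈ δ.verts, v ∈ [((![a + 1, n], 0) : HexVertex), (![a, n], 1), (![a, n], 0),
      (![a, n - 1], 1)]) :
    ∃ (γ₀ : HexMidEdgeSAW Λ s(u, w) s(((![a + 1, n - 1], 1) : HexVertex), ((![a + 1, n], 0) : HexVertex)))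
      (γ₁ : HexMidEdgeSAW Λ s(u, w) s(((![a + 1, n - 1], 0) : HexVertex), ((![a, n - 1], 1) : HexVertex))),
      γ₁.winding = γ₀.winding + Real.pi / 3 := by
  have hZ : ∀ x ∈ [((![a + 1, n], 0) : HexVertex), (![a, n], 1), (![a, n], 0), (![a, n - 1], 1)],
      x ∈ Λ := by
    simp only [List.mem_cons, List.not_mem_nil, or_false]
    rintro x (rfl | rfl | rfl | rfl) <;> assumption
  obtain ⟨A, B, zv, p, hsplit, hzv, hA, hp, hpadj, hpout, hpZ⟩ := first_visit hu huw δ _ hZ hvis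
  have hAS : ∀ S : List HexVertex, (∀ x ∈ S, x ∈ [((![a + 1, n], 0) : HexVertex), (![a, n], 1),
      (![a, n], 0), (![a, n - 1], 1)]) → ∀ x ∈ A, x ∉ S := fun S hS x hx hxS => hA x hx (hS x hxS)
  -- lattice adjacencies along the window and at its two darts
  have aBU : hexGraph.Adj ((![a + 1, n - 1], 1) : HexVertex) (![a + 1, n], 0) := by
    rw [hexGraph_adj_iff_coord]; simp
  have aEM : hexGraph.Adj ((![a + 1, n - 1], 0) : HexVertex) (![a, n - 1], 1) := by
    rw [hexGraph_adj_iff_coord]; simp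
  have aUP : hexGraph.Adj ((![a + 1, n], 0) : HexVertex) (![a, n], 1) := by
    rw [hexGraph_adj_iff_coord]; simp
  have aPP : hexGraph.Adj ((![a, n], 1) : HexVertex) (![a, n], 0) := by
    rw [hexGraph_adj_iff_coord]; simp
  have aPM : hexGraph.Adj ((![a, n], 0) : HexVertex) (![a, n - 1], 1) := by
    rw [hexGraph_adj_iff_coord]; simp
  simp only [List.mem_cons, List.not_mem_nil, or_false] at hzv
  rcases hzv with rfl | rfl | rfl | rfl
  · -- at `U = (a+1,n,0)`: from `(a+1,n,1)` (interior), from `(a,n,1)` (window), from below (root)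
    obtain ⟨h2, ⟨hx, hy⟩ | ⟨hx, hy⟩ | ⟨hx, hy⟩⟩ := adj_up_coord hpadj
    · have hpe : p = (![a + 1, n], 1) := eq_mk_of_coord hx hy h2
      subst hpe
      obtain ⟨γ₀, h₀⟩ := exists_extend hu huw δ hsplit [] (![a + 1, n - 1], 1) (![a + 1, n], 0)
        (by simpa using hU) (List.nodup_singleton _) (List.isChain_singleton _)
        (hAS _ (by simp)) rfl hB aBU h0
      obtain ⟨γ₁, h₁⟩ := exists_extend hu huw δ hsplit [(![a, n], 1), (![a, n], 0), (![a, n - 1], 1)]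
        (![a + 1, n - 1], 0) (![a, n - 1], 1)
        (by simp only [List.mem_cons, List.not_mem_nil, or_false]
            rintro x (rfl | rfl | rfl | rfl) <;> assumption)
        (by simp; omega)
        (List.isChain_cons_cons.2 ⟨aUP, List.isChain_cons_cons.2 ⟨aPP, List.isChain_pair.2 aPM⟩⟩)
        (hAS _ (by simp)) rfl hE aEM h1
      refine ⟨γ₀, γ₁, ?_⟩
      rw [hp] at h₀ h₁
      simp only [List.nil_append, List.cons_append, List.map_cons, List.map_nil, toHV_up,
        toHV_down] at h₀ h₁
      have e₀ : pturn [(a + 1, n, true), (a + 1, n, false), (a + 1, n - 1, true)] = 1 := by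
        simp only [pturn, turn, cross, pos, Bool.false_eq_true, ↓reduceIte, Prod.mk_sub_mk]
        ring_nf; rfl
      have e₁ : pturn [(a + 1, n, true), (a + 1, n, false), (a, n, true), (a, n, false),
          (a, n - 1, true), (a + 1, n - 1, false)] = 2 := by
        simp only [pturn, turn, cross, pos, Bool.false_eq_true, ↓reduceIte, Prod.mk_sub_mk]
        ring_nf; rfl
      rw [h₀, h₁, e₀, e₁]; push_cast; ring
    · exact absurd (eq_mk_of_coord (c := a) (by omega) hy h2) (hpZ _ (by simp))
    · obtain ⟨hux, hzw⟩ := hpout _ hB (eq_mk_of_coord hx hy h2)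
      exact absurd (by rw [hux, ← hzw]) h0
  · -- at `(a,n,1)`: from `(a,n,0)` (window), from `U` (window), from above `(a,n+1,0)`
    obtain ⟨h2, ⟨hx, hy⟩ | ⟨hx, hy⟩ | ⟨hx, hy⟩⟩ := adj_down_coord hpadj
    · exact absurd (eq_mk_of_coord hx hy h2) (hpZ _ (by simp))
    · exact absurd (eq_mk_of_coord hx hy h2) (hpZ _ (by simp))
    · have hpe : p = (![a, n + 1], 0) := eq_mk_of_coord hx hy h2
      subst hpe
      obtain ⟨γ₀, h₀⟩ := exists_extend hu huw δ hsplit [(![a + 1, n], 0)] (![a + 1, n - 1], 1)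
        (![a + 1, n], 0)
        (by simp only [List.mem_cons, List.not_mem_nil, or_false]
            rintro x (rfl | rfl) <;> assumption)
        (by simp) (List.isChain_pair.2 aUP.symm) (hAS _ (by simp)) rfl hB aBU h0
      obtain ⟨γ₁, h₁⟩ := exists_extend hu huw δ hsplit [(![a, n], 0), (![a, n - 1], 1)]
        (![a + 1, n - 1], 0) (![a, n - 1], 1)
        (by simp only [List.mem_cons, List.not_mem_nil, or_false]
            rintro x (rfl | rfl | rfl) <;> assumption)
        (by simp; omega)
        (List.isChain_cons_cons.2 ⟨aPP, List.isChain_pair.2 aPM⟩)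
        (hAS _ (by simp)) rfl hE aEM h1
      refine ⟨γ₀, γ₁, ?_⟩
      rw [hp] at h₀ h₁
      simp only [List.nil_append, List.cons_append, List.map_cons, List.map_nil, toHV_up,
        toHV_down] at h₀ h₁
      have e₀ : pturn [(a, n + 1, false), (a, n, true), (a + 1, n, false), (a + 1, n - 1, true)] = 0 := by
        simp only [pturn, turn, cross, pos, Bool.false_eq_true, ↓reduceIte, Prod.mk_sub_mk]
        ring_nf; rfl
      have e₁ : pturn [(a, n + 1, false), (a, n, true), (a, n, false), (a, n - 1, true),
          (a + 1, n - 1, false)] = 1 := by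
        simp only [pturn, turn, cross, pos, Bool.false_eq_true, ↓reduceIte, Prod.mk_sub_mk]
        ring_nf; rfl
      rw [h₀, h₁, e₀, e₁]; push_cast; ring
  · -- at `(a,n,0)`: from `(a,n,1)` (window), from the west `(a-1,n,1)`, from `M` (window)
    obtain ⟨h2, ⟨hx, hy⟩ | ⟨hx, hy⟩ | ⟨hx, hy⟩⟩ := adj_up_coord hpadj
    · exact absurd (eq_mk_of_coord hx hy h2) (hpZ _ (by simp))
    · have hpe : p = (![a - 1, n], 1) := eq_mk_of_coord hx hy h2
      subst hpe
      obtain ⟨γ₀, h₀⟩ := exists_extend hu huw δ hsplit [(![a, n], 1), (![a + 1, n], 0)]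
        (![a + 1, n - 1], 1) (![a + 1, n], 0)
        (by simp only [List.mem_cons, List.not_mem_nil, or_false]
            rintro x (rfl | rfl | rfl) <;> assumption)
        (by simp)
        (List.isChain_cons_cons.2 ⟨aPP.symm, List.isChain_pair.2 aUP.symm⟩)
        (hAS _ (by simp)) rfl hB aBU h0
      obtain ⟨γ₁, h₁⟩ := exists_extend hu huw δ hsplit [(![a, n - 1], 1)] (![a + 1, n - 1], 0)
        (![a, n - 1], 1)
        (by simp only [List.mem_cons, List.not_mem_nil, or_false]
            rintro x (rfl | rfl) <;> assumption)
        (by simp) (List.isChain_pair.2 aPM) (hAS _ (by simp)) rfl hE aEM h1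
      refine ⟨γ₀, γ₁, ?_⟩
      rw [hp] at h₀ h₁
      simp only [List.nil_append, List.cons_append, List.map_cons, List.map_nil, toHV_up,
        toHV_down] at h₀ h₁
      have e₀ : pturn [(a - 1, n, true), (a, n, false), (a, n, true), (a + 1, n, false),
          (a + 1, n - 1, true)] = -1 := by
        simp only [pturn, turn, cross, pos, Bool.false_eq_true, ↓reduceIte, Prod.mk_sub_mk]
        ring_nf; rfl
      have e₁ : pturn [(a - 1, n, true), (a, n, false), (a, n - 1, true), (a + 1, n - 1, false)] = 0 := by
        simp only [pturn, turn, cross, pos, Bool.false_eq_true, ↓reduceIte, Prod.mk_sub_mk]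
        ring_nf; rfl
      rw [h₀, h₁, e₀, e₁]; push_cast; ring
    · exact absurd (eq_mk_of_coord hx hy h2) (hpZ _ (by simp))
  · -- at `M = (a,n-1,1)`: from `(a,n-1,0)` (interior), from the east (root), from `(a,n,0)` (window)
    obtain ⟨h2, ⟨hx, hy⟩ | ⟨hx, hy⟩ | ⟨hx, hy⟩⟩ := adj_down_coord hpadj
    · have hpe : p = (![a, n - 1], 0) := eq_mk_of_coord hx hy h2
      subst hpe
      obtain ⟨γ₀, h₀⟩ := exists_extend hu huw δ hsplit [(![a, n], 0), (![a, n], 1), (![a + 1, n], 0)]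
        (![a + 1, n - 1], 1) (![a + 1, n], 0)
        (by simp only [List.mem_cons, List.not_mem_nil, or_false]
            rintro x (rfl | rfl | rfl | rfl) <;> assumption)
        (by simp)
        (List.isChain_cons_cons.2 ⟨aPM.symm, List.isChain_cons_cons.2 ⟨aPP.symm,
          List.isChain_pair.2 aUP.symm⟩⟩)
        (hAS _ (by simp)) rfl hB aBU h0
      obtain ⟨γ₁, h₁⟩ := exists_extend hu huw δ hsplit [] (![a + 1, n - 1], 0) (![a, n - 1], 1)
        (by simpa using hM) (List.nodup_singleton _) (List.isChain_singleton _)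
        (hAS _ (by simp)) rfl hE aEM h1
      refine ⟨γ₀, γ₁, ?_⟩
      rw [hp] at h₀ h₁
      simp only [List.nil_append, List.cons_append, List.map_cons, List.map_nil, toHV_up,
        toHV_down] at h₀ h₁
      have e₀ : pturn [(a, n - 1, false), (a, n - 1, true), (a, n, false), (a, n, true),
          (a + 1, n, false), (a + 1, n - 1, true)] = -2 := by
        simp only [pturn, turn, cross, pos, Bool.false_eq_true, ↓reduceIte, Prod.mk_sub_mk]
        ring_nf; rfl
      have e₁ : pturn [(a, n - 1, false), (a, n - 1, true), (a + 1, n - 1, false)] = -1 := by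
        simp only [pturn, turn, cross, pos, Bool.false_eq_true, ↓reduceIte, Prod.mk_sub_mk]
        ring_nf; rfl
      rw [h₀, h₁, e₀, e₁]; push_cast; ring
    · obtain ⟨hux, hzw⟩ := hpout _ hE (eq_mk_of_coord hx hy h2)
      exact absurd (by rw [hux, ← hzw]) h1
    · exact absurd (eq_mk_of_coord hx (d := n) (by omega) h2) (hpZ _ (by simp))

end SidePhaseCorner

/-! ### Registered form -/

/-- **Registered helper `sidePhaseCorner_step_three_convex`** (support for `sidePhase_corner`, line
`polygon-parity-squeeze`, crux stmt-CriticalPhenomena-14004): the corner step of the winding at a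
convex corner of forms `0`, `3` (binder-free form of `SidePhaseCorner.step_three_convex`; the
reflex corner is `SidePhaseCorner.step_three_reflex`).
[cite: DuminilCopinSmirnov2012, §3 (winding of walks to the boundary)] -/
theorem sidePhaseCorner_step_three_convex : ∀ (Λ : Finset HexVertex) (u w : HexVertex), u ∉ Λ → hexGraph.Adj u w → ∀ (a n : ℤ), ((![a, n], 0) : HexVertex) ∈ Λ → ((![a, n], 1) : HexVertex) ∈ Λ → ((![a, n - 1], 1) : HexVertex) ∉ Λ → ((![a + 1, n], 0) : HexVertex) ∉ Λ → s(u, w) ≠ s(((![a, n - 1], 1) : HexVertex), ((![a, n], 0) : HexVertex)) → s(u, w) ≠ s(((![a + 1, n], 0) : HexVertex), ((![a, n], 1) : HexVertex)) → ∀ (z : Sym2 HexVertex) (δ : HexMidEdgeSAW Λ s(u, w) z), (∃ v ∈ δ.verts, v ∈ [((![a, n], 0) : HexVertex), (![a, n], 1)]) → ∃ (γ₀ : HexMidEdgeSAW Λ s(u, w) s(((![a, n - 1], 1) : HexVertex), ((![a, n], 0) : HexVertex))) (γ₁ : HexMidEdgeSAW Λ s(u, w) s(((![a + 1, n], 0)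 : HexVertex), ((![a, n], 1) : HexVertex))), γ₁.winding = γ₀.winding + Real.pi / 3 :=
  fun _ _ _ hu huw _ _ hU hM hB hE h0 h1 _ δ hvis =>
    SidePhaseCorner.step_three_convex hu huw hU hM hB hE h0 h1 δ hvis

end Summit.CriticalPhenomena.SAWScalingLimit.Theorems.PolygonParitySqueeze

end
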